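import Mathlib
import Literature.Computability.AlgebraicComplexity.ASSS16DescentFaithful
import Literature.Computability.AlgebraicComplexity.ASSS16SparseLeafMinors
import Literature.Computability.AlgebraicComplexity.FSV18OccurDegreeBound
import HarnessLib

/-!
# [ASSS16] §4, base of the level recursion: the last Vandermonde block ⊕ the sparse-hitting `Φ`
# is faithful to every small family of derivatives of the leaves — proofs only (N1 push, F4 base)

M. Agrawal, C. Saha, R. Saptharishi, N. Saxena, arXiv:1111.0582 [AgrawalEtAl2011], §4, proof of
Theorem `thm:dDkrPIT` (p0010:L44–L58): "we eventually reach the level of the sparse polynomials …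
and are required to construct a map `Ψ_{D-2}` that is faithful to a collection `𝒞_{D-2}` of … sets
of derivatives of sparse polynomials, each set containing at most `r_{D-2}` elements. … Let
`𝒰 ∈ 𝒞_{D-2}` with transcendence basis `𝒰'`. Any `|𝒰'| × |𝒰'|` minor of `𝒥_x(𝒰')` is a sparse
polynomial with sparsity bounded by `s^R` … the nonzeroness of this determinant is maintained by
[the sparse-hitting map `Φ`] … Therefore … `Ψ_{D-2} : x_i ↦ Σ_{j=1}^{R} y_j t^{ij} + Φ(x_i)` is
faithful to `𝒞_{D-2}`."

In the val-lit F4 design (lead-np RULINGS (34)–(36); t18 g3's keystone `INV(j)`, bus 2026-08-26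
18:43Z) the level invariant is carried in [ASSS16] Thm. 2.1 form — "`C(U) ≠ 0 ⇔ C(Ψ ∘ U) ≠ 0` for
every polynomial `C`" — and the base case is the statement of this file:

* `ASSS16.baseLevel_faithful` — for a family `U_u = Δ_{β_u} p_u` (`u < m ≤ r`) of iterated partial
  derivatives (`iterPderiv`) of polynomials `p_u` with `≤ s` monomials and degree `≤ d`
  (`char(𝔽) = 0` or `> d^r`, `1 ≤ s`, `r!·s^r ≤ B`), any algebra map `Ψ` that SPECIALISES to a
  hitting-set generator `Φ` for sparsity `≤ B` (an algebra map `S` with `S (Ψ x_m) = Φ_m`; e.g. `Ψ`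
  = `Φ` on fresh variables plus dead Vandermonde blocks, `ASSS16.bind₁_vdmBlocks_add_rename_ne_zero`)
  and a fresh block `emb : Fin r ⊕ Unit ↪ σ` off the variables of `Ψ`:
  `C(U) ≠ 0 ↔ C((Vdm_r ⊕ Ψ) ∘ U) ≠ 0`. Proof = p2 g3's `exists_trdeg_jacobianMinor_ne_zero` (a
  nonzero maximal Jacobian minor) → this seat's `card_support_det_jacobian_iterPderiv_le` (the minor
  has `≤ ρ!·s^ρ ≤ B` monomials, so `Φ`, hence `Ψ`, keeps it nonzero) → p2 g3's `descentFaithful`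
  ([ASSS16] Lemma 2.2 / Cor. 4.3 in minor form).
* Model lemmas placing FSV Def. 45 formulas of depth `≤ 2` (the bottom level of t18's induction:
  leaves, and the degenerate empty gates computing constants) under these hypotheses:
  `OccurFormula.two_le_depth_or_eval_eq_C`-type facts — `one_le_depth`, `exists_eval_eq_C_of_depth_le_one`,
  `leaf_or_exists_eval_eq_C_of_depth_le_two`, `card_support_eval_le_of_depth_le_two`
  (`|supp φ.eval| ≤ s` when `φ.size ≤ s`, `φ.depth ≤ 2`, `1 ≤ s`); and for every level
  `OccurFormula.totalDegree_iterPderiv_eval_le` (`deg Δ_β φ.eval ≤ (s+1)^e` for size `≤ s`,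
  depth `≤ e`).

No definitions, no named facts. Honest framing: one step of the formalisation of [ASSS16]'s proof
of FSV Thm. 48 on the reduced class (`FSV2018_thm48_topFanIn`); nothing here bears on `VP ≠ VNP`,
which is NOT proved.

## References
* [AgrawalEtAl2011] arXiv:1111.0582 §4, proof of Thm. dDkrPIT, bottom level (locator:
  paper:arxiv-1111.0582 p0010.txt:L44–L58); Lemma 2.2 (p0006.txt:L45–L60).
* [ForbesShpilkaVolk2018] Def. 45, Construction 46, Thm. 48 (seq.) = ToC Def. 5.21, Constr. 5.22,
  Thm. 5.24 — the model and the block layout.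
-/

noncomputable section

namespace Literature.Computability.AlgebraicComplexity

open MvPolynomial Finset Literature.Barriers.ValiantsHypothesis

open scoped BigOperators

open Literature.RepresentationTheory.AlgebraicGroups (iterPderiv)

variable {F : Type*} [Field F] {ι : Type*}

/-! ### Depth-`≤ 2` formulas are leaves or constants -/

/-- Every formula has depth `≥ 1` (leaves have depth `2`, gates `1 + …`).
[cite: ForbesShpilkaVolk2018, Def. 45 (seq.) = ToC Def. 5.21] locator: paper:arxiv-1701.05328 p0020.txt:L65 -/
theorem OccurFormula.one_le_depth : ∀ φ : OccurFormula F ι, 1 ≤ φ.depth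
  | .leaf _ => by rw [OccurFormula.depth]; norm_num
  | .add _ => by rw [OccurFormula.depth]; exact Nat.le_add_right _ _
  | .powProd _ => by rw [OccurFormula.depth]; exact Nat.le_add_right _ _

/-- A `+` argument list of depth `0` is empty, so it sums to `0`.
[cite: ForbesShpilkaVolk2018, Def. 45 (seq.) = ToC Def. 5.21] locator: paper:arxiv-1701.05328 p0020.txt:L65 -/
theorem OccurArgs.evalSum_eq_zero_of_depth_eq_zero : ∀ as : OccurArgs F ι,
    as.depth = 0 → as.evalSum = 0
  | .nil => fun _ => by rw [OccurArgs.evalSum]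
  | .cons φ rest => fun h => by
    rw [OccurArgs.depth] at h
    have := OccurFormula.one_le_depth φ
    have := le_max_left φ.depth rest.depth
    omega

/-- A `×∧` argument list of depth `0` is empty, so its product is `1`.
[cite: ForbesShpilkaVolk2018, Def. 45 (seq.) = ToC Def. 5.21] locator: paper:arxiv-1701.05328 p0020.txt:L65 -/
theorem OccurPowArgs.evalProd_eq_one_of_depth_eq_zero : ∀ ps : OccurPowArgs F ι,
    ps.depth = 0 → ps.evalProd = 1
  | .nil => fun _ => by rw [OccurPowArgs.evalProd]
  | .cons φ e rest => fun h => by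
    rw [OccurPowArgs.depth] at h
    have := OccurFormula.one_le_depth φ
    have := le_max_left φ.depth rest.depth
    omega

/-- A formula of depth `≤ 1` is an empty gate and computes a constant (`0` or `1`).
[cite: ForbesShpilkaVolk2018, Def. 45 (seq.) = ToC Def. 5.21] locator: paper:arxiv-1701.05328 p0020.txt:L65 -/
theorem OccurFormula.exists_eval_eq_C_of_depth_le_one : ∀ φ : OccurFormula F ι,
    φ.depth ≤ 1 → ∃ c : F, φ.eval = C c
  | .leaf _ => fun h => by rw [OccurFormula.depth] at h; omega
  | .add as => fun h => by
    rw [OccurFormula.depth] at h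
    refine ⟨0, ?_⟩
    rw [OccurFormula.eval, OccurArgs.evalSum_eq_zero_of_depth_eq_zero as (by omega), C_0]
  | .powProd ps => fun h => by
    rw [OccurFormula.depth] at h
    refine ⟨1, ?_⟩
    rw [OccurFormula.eval, OccurPowArgs.evalProd_eq_one_of_depth_eq_zero ps (by omega), C_1]

/-- `+` argument lists of depth `≤ 1` sum to a constant. [cite: ForbesShpilkaVolk2018, Def. 45 (seq.) = ToC Def. 5.21]
locator: paper:arxiv-1701.05328 p0020.txt:L65 -/
theorem OccurArgs.exists_evalSum_eq_C_of_depth_le_one : ∀ as : OccurArgs F ι,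
    as.depth ≤ 1 → ∃ c : F, as.evalSum = C c
  | .nil => fun _ => ⟨0, by rw [OccurArgs.evalSum, C_0]⟩
  | .cons φ rest => fun h => by
    rw [OccurArgs.depth] at h
    obtain ⟨a, ha⟩ := OccurFormula.exists_eval_eq_C_of_depth_le_one φ ((le_max_left _ _).trans h)
    obtain ⟨b, hb⟩ := OccurArgs.exists_evalSum_eq_C_of_depth_le_one rest ((le_max_right _ _).trans h)
    exact ⟨a + b, by rw [OccurArgs.evalSum, ha, hb, C_add]⟩

/-- `×∧` argument lists of depth `≤ 1` multiply to a constant. [cite: ForbesShpilkaVolk2018, Def. 45 (seq.) = ToC Def. 5.21]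
locator: paper:arxiv-1701.05328 p0020.txt:L65 -/
theorem OccurPowArgs.exists_evalProd_eq_C_of_depth_le_one : ∀ ps : OccurPowArgs F ι,
    ps.depth ≤ 1 → ∃ c : F, ps.evalProd = C c
  | .nil => fun _ => ⟨1, by rw [OccurPowArgs.evalProd, C_1]⟩
  | .cons φ e rest => fun h => by
    rw [OccurPowArgs.depth] at h
    obtain ⟨a, ha⟩ := OccurFormula.exists_eval_eq_C_of_depth_le_one φ ((le_max_left _ _).trans h)
    obtain ⟨b, hb⟩ := OccurPowArgs.exists_evalProd_eq_C_of_depth_le_one rest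
      ((le_max_right _ _).trans h)
    exact ⟨a ^ e * b, by rw [OccurPowArgs.evalProd, ha, hb, C_mul, C_pow]⟩

/-- **A formula of depth `≤ 2` is a leaf or computes a constant** (the bottom level of the
recursion: "the level of the sparse polynomials").
[cite: AgrawalEtAl2011, §4 (Thm. dDkrPIT, proof); ForbesShpilkaVolk2018, Def. 45 (seq.) = ToC Def. 5.21]
locator: paper:arxiv-1111.0582 p0010.txt:L44–L46 -/
theorem OccurFormula.leaf_or_exists_eval_eq_C_of_depth_le_two : ∀ φ : OccurFormula F ι,
    φ.depth ≤ 2 → (∃ p, φ = .leaf p) ∨ ∃ c : F, φ.eval = C c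
  | .leaf p => fun _ => Or.inl ⟨p, rfl⟩
  | .add as => fun h => by
    rw [OccurFormula.depth] at h
    obtain ⟨c, hc⟩ := OccurArgs.exists_evalSum_eq_C_of_depth_le_one as (by omega)
    exact Or.inr ⟨c, by rw [OccurFormula.eval, hc]⟩
  | .powProd ps => fun h => by
    rw [OccurFormula.depth] at h
    obtain ⟨c, hc⟩ := OccurPowArgs.exists_evalProd_eq_C_of_depth_le_one ps (by omega)
    exact Or.inr ⟨c, by rw [OccurFormula.eval, hc]⟩

/-- **Sparsity at the bottom level:** a formula of depth `≤ 2` and size `≤ s` (`1 ≤ s`) computes a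
polynomial with at most `s` monomials (a leaf has at most size-many monomials; a constant has at
most one). [cite: AgrawalEtAl2011, §4 (Thm. dDkrPIT, proof: "sparse polynomials … sparsity"); ForbesShpilkaVolk2018, Def. 45 (seq.) = ToC Def. 5.21 (size of a leaf)]
locator: paper:arxiv-1111.0582 p0010.txt:L52–L54 -/
theorem OccurFormula.card_support_eval_le_of_depth_le_two {s : ℕ} (hs : 1 ≤ s)
    (φ : OccurFormula F ι) (hd : φ.depth ≤ 2) (hsize : φ.size ≤ s) :
    φ.eval.support.card ≤ s := by
  rcases OccurFormula.leaf_or_exists_eval_eq_C_of_depth_le_two φ hd with ⟨p, rfl⟩ | ⟨c, hc⟩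
  · rw [OccurFormula.eval]
    rw [OccurFormula.size] at hsize
    exact (ASSS16.card_support_le_leafSize p).trans hsize
  · rw [hc]
    classical
    refine (Finset.card_le_card (support_monomial_subset (s := (0 : ι →₀ ℕ)) (a := c))).trans ?_
    rw [Finset.card_singleton]
    exact hs

/-- **Degree bound of a level family member:** a derivative `Δ_β φ.eval` of a sub-formula of size
`≤ s` and depth `≤ e` has total degree `≤ (s+1)^e` (FSV's size convention, via
`OccurFormula.totalDegree_eval_le` and `ASSS16.totalDegree_iterPderiv_le`) — the `d` of the
Jacobian criterion / Lemma 2.2 at that level.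
[cite: AgrawalEtAl2011, §4 (¶1 "the bound on the degree of `C`") with Lemma 2.2; ForbesShpilkaVolk2018, Def. 45 (seq.) = ToC Def. 5.21]
locator: paper:arxiv-1111.0582 p0009.txt:L6; p0006.txt:L45–L50 -/
theorem OccurFormula.totalDegree_iterPderiv_eval_le [DecidableEq ι] {s e : ℕ} (φ : OccurFormula F ι)
    (hsize : φ.size ≤ s) (hd : φ.depth ≤ e) (β : ι →₀ ℕ) :
    (iterPderiv (A := F) β φ.eval).totalDegree ≤ (s + 1) ^ e :=
  (ASSS16.totalDegree_iterPderiv_le β φ.eval).trans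
    ((OccurFormula.totalDegree_eval_le φ).trans
      ((Nat.pow_le_pow_left (Nat.succ_le_succ hsize) _).trans
        (Nat.pow_le_pow_right (Nat.succ_pos s) hd)))

namespace ASSS16

/-! ### The base case of the level induction -/

variable {n : ℕ}

/-- **[ASSS16] §4, base of the recursion ("`Ψ_{D-2}` is faithful to `𝒞_{D-2}`"), in Thm. 2.1
form.** Let `U_u = Δ_{β_u} p_u` (`u < m`, `m ≤ r`) be iterated partial derivatives of polynomials
`p_u` in the `2^n` coefficient variables with at most `s ≥ 1` monomials and degree `≤ d`, and assume
`char(𝔽) = 0` or `char(𝔽) > d^r`. Let `Ψ` be an algebra map into the seed variables `σ` that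
SPECIALISES (along some algebra map `S`) to a hitting-set generator `Φ` for the polynomials with at
most `B ≥ r!·s^r` monomials, and let `emb : Fin r ⊕ Unit ↪ σ` be a fresh Vandermonde block (no
variable of any `Ψ x_m` lies in its range). Then for every `C`:
`C(U) ≠ 0 ↔ C((x_m ↦ Vdm_r(m) + Ψ x_m) ∘ U) ≠ 0`.
[cite: AgrawalEtAl2011, §4 (Thm. dDkrPIT, proof, bottom level) with Lemma 2.2 / Cor. 4.3]
locator: paper:arxiv-1111.0582 p0010.txt:L44–L58 -/
theorem baseLevel_faithful {m r d s B : ℕ} {σ τ : Type*}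
    (p : Fin m → MvPolynomial (multilinearMonomials n) F)
    (β : Fin m → multilinearMonomials n →₀ ℕ)
    (hs : 1 ≤ s) (hp : ∀ u, (p u).support.card ≤ s) (hdeg : ∀ u, (p u).totalDegree ≤ d)
    (hm : m ≤ r) (hchar : ringChar F = 0 ∨ d ^ r < ringChar F) (hB : r.factorial * s ^ r ≤ B)
    (Φ : multilinearMonomials n → MvPolynomial τ F)
    (hΦ : IsHittingSetGenerator
      {P : MvPolynomial (multilinearMonomials n) F | P.support.card ≤ B} Φ)
    (Ψ : MvPolynomial (multilinearMonomials n) F →ₐ[F] MvPolynomial σ F)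
    (S : MvPolynomial σ F →ₐ[F] MvPolynomial τ F) (hS : ∀ mm, S (Ψ (X mm)) = Φ mm)
    (emb : Fin r ⊕ Unit → σ) (hemb : Function.Injective emb)
    (hfresh : ∀ mm : multilinearMonomials n, ∀ v ∈ (Ψ (X mm)).vars, v ∉ Set.range emb)
    (C : MvPolynomial (Fin m) F) :
    aeval (fun u => iterPderiv (A := F) (β u) (p u)) C ≠ 0 ↔
      aeval (fun u => aeval (fun mm : multilinearMonomials n =>
        rename emb (vdmGenCoeff F n r (mm : Fin n →₀ ℕ)) + Ψ (X mm))
          (iterPderiv (A := F) (β u) (p u))) C ≠ 0 := by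
  classical
  haveI : Fintype (multilinearMonomials n) := Fintype.ofEquiv (Fin (2 ^ n)) (binaryOrder n)
  set U : Fin m → MvPolynomial (multilinearMonomials n) F := fun u => iterPderiv (A := F) (β u) (p u)
    with hU
  -- degrees and transcendence degree of the derivative family
  have hdegU : ∀ u, (U u).totalDegree ≤ d := fun u =>
    (totalDegree_iterPderiv_le (β u) (p u)).trans (hdeg u)
  have htr : TrdegLE F U r := trdegLE_fin_of_le U hm
  -- (S0) a nonzero maximal Jacobian minor of `U`
  obtain ⟨ρ, hρr, hρ, rows, cols, -, -, hdet⟩ :=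
    exists_trdeg_jacobianMinor_ne_zero U hdegU htr hchar
  -- the minor is sparse, so `Φ` — hence `Ψ` — keeps it nonzero
  have hΦdet : MvPolynomial.bind₁ Φ
      (Matrix.of fun u v => pderiv (cols v) (U (rows u))).det ≠ 0 := by
    have h := bind₁_det_jacobian_iterPderiv_ne_zero (R := r) (s := s) Φ
      (fun P hP hP0 => hΦ P (le_trans hP hB) hP0) hρr hs (fun u => p (rows u))
      (fun u => β (rows u)) cols (fun u => hp (rows u)) hdet
    exact h
  have hΨdet : Ψ (Matrix.of fun u v => pderiv (cols v) (U (rows u))).det ≠ 0 := by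
    have h1 : Ψ (Matrix.of fun u v => pderiv (cols v) (U (rows u))).det =
        MvPolynomial.bind₁ (fun mm => Ψ (X mm))
          (Matrix.of fun u v => pderiv (cols v) (U (rows u))).det := by
      rw [← MvPolynomial.aeval_eq_bind₁]
      exact congrArg (fun f : MvPolynomial (multilinearMonomials n) F →ₐ[F] MvPolynomial σ F =>
        f (Matrix.of fun u v => pderiv (cols v) (U (rows u))).det) (MvPolynomial.aeval_unique Ψ)
    rw [h1]
    exact bind₁_ne_zero_of_algHom_comp_eq _ Φ (fun mm => Ψ (X mm)) S hS hΦdet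
  -- (S1) Lemma 2.2 / Cor. 4.3 in minor form
  exact descentFaithful U hdegU htr hchar Ψ emb hemb hfresh hρ rows cols hΨdet C

/-- **The base case in the keystone's binder shape** (val-lit t18 g3, bus 2026-08-26 18:53Z): the
next-level map is `Φ` renamed into the seed type along an injection `ι` disjoint from the fresh
block `emb`, and the degree hypothesis is on the derivatives themselves. Same content as
`baseLevel_faithful` (with `Ψ := aeval (rename ι ∘ Φ)`, `S := killCompl ι`).
[cite: AgrawalEtAl2011, §4 (Thm. dDkrPIT, proof, bottom level) with Lemma 2.2 / Cor. 4.3]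
locator: paper:arxiv-1111.0582 p0010.txt:L44–L58 -/
theorem baseLevel {m r d s B : ℕ} {σ τ : Type*}
    (p : Fin m → MvPolynomial (multilinearMonomials n) F)
    (β : Fin m → multilinearMonomials n →₀ ℕ)
    (hs : 1 ≤ s) (hsupp : ∀ i, (p i).support.card ≤ s)
    (hdeg : ∀ i, (iterPderiv (A := F) (β i) (p i)).totalDegree ≤ d)
    (hm : m ≤ r) (hchar : ringChar F = 0 ∨ d ^ r < ringChar F) (hB : r.factorial * s ^ r ≤ B)
    (Φ : multilinearMonomials n → MvPolynomial τ F)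
    (hΦ : IsHittingSetGenerator
      {P : MvPolynomial (multilinearMonomials n) F | P.support.card ≤ B} Φ)
    (ι : τ → σ) (hι : Function.Injective ι)
    (emb : Fin r ⊕ Unit → σ) (hemb : Function.Injective emb) (hdisj : ∀ v w, emb v ≠ ι w)
    (C : MvPolynomial (Fin m) F) :
    aeval (fun i => iterPderiv (A := F) (β i) (p i)) C ≠ 0 ↔
      aeval (fun i => aeval (fun mm : multilinearMonomials n =>
        rename emb (vdmGenCoeff F n r (mm : Fin n →₀ ℕ)) + rename ι (Φ mm))
          (iterPderiv (A := F) (β i) (p i))) C ≠ 0 := by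
  classical
  haveI : Fintype (multilinearMonomials n) := Fintype.ofEquiv (Fin (2 ^ n)) (binaryOrder n)
  set U : Fin m → MvPolynomial (multilinearMonomials n) F := fun u => iterPderiv (A := F) (β u) (p u)
    with hU
  have htr : TrdegLE F U r := trdegLE_fin_of_le U hm
  -- the next-level map `Ψ = rename ι ∘ Φ` as an algebra map, and its left inverse `killCompl`
  let Ψ : MvPolynomial (multilinearMonomials n) F →ₐ[F] MvPolynomial σ F :=
    aeval fun mm => rename ι (Φ mm)
  have hΨX : ∀ mm, Ψ (X mm) = rename ι (Φ mm) := fun mm => by simp only [Ψ, aeval_X]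
  have hS : ∀ mm, killCompl hι (Ψ (X mm)) = Φ mm := fun mm => by
    rw [hΨX, killCompl_rename_app]
  have hfresh : ∀ mm : multilinearMonomials n, ∀ v ∈ (Ψ (X mm)).vars, v ∉ Set.range emb := by
    intro mm v hv ⟨u, hu⟩
    rw [hΨX] at hv
    obtain ⟨w, -, rfl⟩ := Finset.mem_image.mp (vars_rename ι (Φ mm) hv)
    exact hdisj u w hu
  -- (S0) a nonzero maximal Jacobian minor of `U`
  obtain ⟨ρ, hρr, hρ, rows, cols, -, -, hdet⟩ :=
    exists_trdeg_jacobianMinor_ne_zero U hdeg htr hchar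
  -- the minor is sparse, so `Φ` — hence `Ψ` — keeps it nonzero
  have hΦdet : MvPolynomial.bind₁ Φ
      (Matrix.of fun u v => pderiv (cols v) (U (rows u))).det ≠ 0 :=
    bind₁_det_jacobian_iterPderiv_ne_zero (R := r) (s := s) Φ
      (fun P hP hP0 => hΦ P (le_trans hP hB) hP0) hρr hs (fun u => p (rows u))
      (fun u => β (rows u)) cols (fun u => hsupp (rows u)) hdet
  have hΨdet : Ψ (Matrix.of fun u v => pderiv (cols v) (U (rows u))).det ≠ 0 := by
    have h1 : Ψ (Matrix.of fun u v => pderiv (cols v) (U (rows u))).det =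
        MvPolynomial.bind₁ (fun mm => Ψ (X mm))
          (Matrix.of fun u v => pderiv (cols v) (U (rows u))).det := by
      rw [← MvPolynomial.aeval_eq_bind₁]
      exact congrArg (fun f : MvPolynomial (multilinearMonomials n) F →ₐ[F] MvPolynomial σ F =>
        f (Matrix.of fun u v => pderiv (cols v) (U (rows u))).det) (MvPolynomial.aeval_unique Ψ)
    rw [h1]
    exact bind₁_ne_zero_of_algHom_comp_eq _ Φ (fun mm => Ψ (X mm)) (killCompl hι) hS hΦdet
  -- (S1) Lemma 2.2 / Cor. 4.3 in minor form, then unfold `Ψ (X mm)`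
  have h := descentFaithful U hdeg htr hchar Ψ emb hemb hfresh hρ rows cols hΨdet C
  simp only [hΨX] at h
  exact h

end ASSS16

end Literature.Computability.AlgebraicComplexity
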